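import Literature.Combinatorics.SimpleGraph.HeilmannLiebTheorem
import Literature.Algebra.Polynomial.NewtonInequalities
import HarnessLib

/-!
# The matchings polynomial of a graph, XI: the matching numbers `p(G, r)` are log-concave
# (Heilmann–Lieb 1972, Theorem 7.1 — Newton's inequalities for `R(G; x)`)

Source (held text `paper:doi-10-1007-bf01877590`, PDF pages): O. J. Heilmann, E. H. Lieb, *Theory
of monomer-dimer systems*, Commun. Math. Phys. 25 (1972) 190–232 [HeilmannLieb1972], §VII
(p0027): with `Z_d` the number of dimer arrangements with `d` dimers (§II (2.3); for unit weights
`Z_d = p(G, d)`, the number of `d`-matchings), `N` the number of vertices, `M = [N/2]` (2.4), and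
`R(G; x)` the polynomial of degree `M` with `P(G; x) = Σ_d Z_d x^{N−2d}`, `Q(G; x) = i^{−N}P(G; ix)`
(= `μ(G, x)`), `R(G; x²) = x^{−N} P(G; x)` resp. `x^{1−N} P(G; x)` (2.7): «The numbers `−b_1, …, −b_M`
(with `M = [N/2]`) are the zeros of `R(G; x)`. **Theorem 7.1.** The canonical partition function `Z_d`
satisfies the inequality: `2 ln Z_d ≥ ln Z_{d−1} + ln Z_{d+1} + ln(1 + 1/d) + ln(1 + 1/(M+1−d))`
[sic; (7.3)]. Remark 7.1. This inequality states that even for finite systems the free energy per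
unit volume is a strictly convex function of the dimer density. Proof. If Newton's inequality is
applied to `R(G; x)` which is a polynomial of degree `M` having `M` real zeros (according to Theorem
4.2), then one gets (7.4) which trivially yields (7.1).»

Rendering (unit weights, Mathlib `SimpleGraph`, part I's `matchingNumber G r = p(G, r)`): with
`n = |V|`, `M = n / 2`, the polynomial `S(y) = Σ_{r ≤ M} (−1)^r p(G, r) y^{M−r} ∈ ℝ[y]`
(`= ±R(G; −y)`) satisfies `μ(G, x) = x^{n − 2M} S(x²)`, so by the Heilmann–Lieb theorem
(part II, `HeilmannLiebTheorem.im_eq_zero_of_isRoot`: the zeros of `μ(G, x)` are real) every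
complex zero `y = x²` of `S` is real, i.e. `S` is real-rooted of degree `M`; Newton's inequality
(`Literature.Algebra.Polynomial.NewtonInequalities.coeff_mul_coeff_le_sq_shift`, whose coefficient
signs `(−1)^{d−1}(−1)^{d+1} = 1` cancel) gives

* **`matchingNumber_newton`** — Theorem 7.1 for unit weights, exponentiated and cleared of
  denominators: `(d+1)(M−d+1) · p(G, d−1) p(G, d+1) ≤ d(M−d) · p(G, d)²` for `0 < d < M`
  (i.e. `Z_d² ≥ Z_{d−1}Z_{d+1}(1 + 1/d)(1 + 1/(M−d))`);
* **`matchingNumber_logConcave`** — the sequence `p(G, 0), p(G, 1), …` is log-concave: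
  `p(G, d−1) p(G, d+1) ≤ p(G, d)²` for every `d ≥ 1` (for `d ≥ M` because `p(G, d+1) = 0`).

Theorems only (the auxiliary polynomial is local to the proofs); weighted graphs TODO(general form).
-/

open Finset Polynomial
open Literature.Combinatorics.SimpleGraph.MatchingsPolynomial
open Literature.Combinatorics.SimpleGraph.HeilmannLiebTheorem
open Literature.Algebra.Polynomial.NewtonInequalities

namespace Literature.Combinatorics.SimpleGraph.MatchingNumbersLogConcave

variable {V : Type*} [Fintype V] [DecidableEq V] (G : SimpleGraph V) [DecidableRel G.Adj]

/-! ### The half-degree polynomial `S(y) = Σ_r (−1)^r p(G, r) y^{M−r}` -/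

/-- The coefficient of `y^{M−d}` in `S(y) = Σ_{r ≤ M} (−1)^r p(G,r) y^{M−r}` is `(−1)^d p(G, d)`. [folklore] -/
private theorem coeff_halfPoly {M d : ℕ} (hd : d ≤ M) :
    (∑ r ∈ range (M + 1), C ((-1) ^ r * (matchingNumber G r : ℝ)) * X ^ (M - r)).coeff (M - d) =
      (-1) ^ d * (matchingNumber G d : ℝ) := by
  rw [finsetSum_coeff, sum_eq_single d]
  · rw [coeff_C_mul_X_pow, if_pos rfl]
  · intro r hr hne
    rw [coeff_C_mul_X_pow, if_neg]
    have := mem_range.1 hr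
    omega
  · intro h
    exact absurd (mem_range.2 (by omega)) h

/-- `S` has degree `M` (it is monic: `p(G, 0) = 1`). [folklore] -/
private theorem natDegree_halfPoly (M : ℕ) :
    (∑ r ∈ range (M + 1), C ((-1) ^ r * (matchingNumber G r : ℝ)) * X ^ (M - r)).natDegree = M := by
  refine natDegree_eq_of_le_of_coeff_ne_zero ?_ ?_
  · exact natDegree_sum_le_of_forall_le _ _ fun r _ =>
      (natDegree_C_mul_X_pow_le _ _).trans (Nat.sub_le _ _)
  · have h := coeff_halfPoly G (Nat.zero_le M)
    rw [Nat.sub_zero] at h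
    rw [h, matchingNumber_zero]
    norm_num

/-- `μ(G, w) = w^{n − 2M} · S(w²)` over `ℂ` (`n = 2M + (n mod 2)`). [cite: HeilmannLieb1972, §II (2.7), held p0006] -/
private theorem eval_matchingsPoly_eq_mul_aeval (w : ℂ) :
    (matchingsPoly G ℂ).eval w = w ^ (Fintype.card V % 2) *
      aeval (w ^ 2) (∑ r ∈ range (Fintype.card V / 2 + 1),
        C ((-1) ^ r * (matchingNumber G r : ℝ)) * X ^ (Fintype.card V / 2 - r)) := by
  rw [matchingsPoly, eval_finsetSum, map_sum, mul_sum]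
  refine sum_congr rfl fun r hr => ?_
  have hr' := mem_range.1 hr
  rw [eval_mul, eval_mul, eval_pow, eval_neg, eval_one, eval_natCast, eval_pow, eval_X, map_mul,
    aeval_C, map_pow, aeval_X, map_mul, map_pow, map_neg, map_one, map_natCast, ← pow_mul,
    show Fintype.card V - 2 * r = Fintype.card V % 2 + 2 * (Fintype.card V / 2 - r) by omega,
    pow_add]
  ring

/-- **`S` is real-rooted** (H–L: «`R(G; x)` … is a polynomial of degree `M` having `M` real zeros
(according to Theorem 4.2)»): a complex zero `y` of `S` is `y = w²` with `μ(G, w) = 0`, so `w`, and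
hence `y`, is real. [cite: HeilmannLieb1972, §VII Theorem 7.1 (proof), held p0027] -/
private theorem splits_halfPoly :
    (∑ r ∈ range (Fintype.card V / 2 + 1),
      C ((-1) ^ r * (matchingNumber G r : ℝ)) * X ^ (Fintype.card V / 2 - r)).Splits := by
  refine Literature.Analysis.Complex.PolyaSchur.splits_of_forall_aeval_eq_zero_im_eq_zero
    fun z hz => ?_
  obtain ⟨w, rfl⟩ := IsAlgClosed.exists_pow_nat_eq z two_pos
  have hroot : (matchingsPoly G ℂ).IsRoot w := by
    rw [IsRoot.def, eval_matchingsPoly_eq_mul_aeval, hz, mul_zero]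
  have him := im_eq_zero_of_isRoot G hroot
  simp [pow_two, Complex.mul_im, him]

/-! ### Theorem 7.1 -/

/-- **Heilmann–Lieb Theorem 7.1 (unit weights): Newton's inequality for the matching numbers** —
«`2 ln Z_d ≥ ln Z_{d−1} + ln Z_{d+1} + ln(1 + 1/d) + ln(1 + 1/(M−d))`» with `Z_d = p(G, d)`,
`M = ⌊n/2⌋`, here exponentiated and cleared of denominators:
`(d+1)(M−d+1) · p(G, d−1) p(G, d+1) ≤ d(M−d) · p(G, d)²` for `0 < d < M` («If Newton's inequality is
applied to `R(G; x)` which is a polynomial of degree `M` having `M` real zeros …»).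
[cite: HeilmannLieb1972, §VII Theorem 7.1, held p0027] -/
theorem matchingNumber_newton {d : ℕ} (hd : 0 < d) (hdM : d < Fintype.card V / 2) :
    (d + 1) * (Fintype.card V / 2 - d + 1) * (matchingNumber G (d - 1) * matchingNumber G (d + 1)) ≤
      d * (Fintype.card V / 2 - d) * matchingNumber G d ^ 2 := by
  obtain ⟨k, rfl⟩ : ∃ k, d = k + 1 := ⟨d - 1, by omega⟩
  obtain ⟨i, hi⟩ : ∃ i, Fintype.card V / 2 = i + k + 2 := ⟨Fintype.card V / 2 - k - 2, by omega⟩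
  set M := Fintype.card V / 2 with hM
  set S : ℝ[X] := ∑ r ∈ range (M + 1), C ((-1) ^ r * (matchingNumber G r : ℝ)) * X ^ (M - r)
    with hS
  have hdeg : S.natDegree = i + k + 2 := by rw [hS, natDegree_halfPoly, hi]
  have h := coeff_mul_coeff_le_sq_shift (splits_halfPoly G) hdeg
  have hc0 : S.coeff i = (-1) ^ (k + 2) * (matchingNumber G (k + 2) : ℝ) := by
    rw [show i = M - (k + 2) by omega]; exact coeff_halfPoly G (by omega)
  have hc1 : S.coeff (i + 1) = (-1) ^ (k + 1) * (matchingNumber G (k + 1) : ℝ) := by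
    rw [show i + 1 = M - (k + 1) by omega]; exact coeff_halfPoly G (by omega)
  have hc2 : S.coeff (i + 2) = (-1) ^ k * (matchingNumber G k : ℝ) := by
    rw [show i + 2 = M - k by omega]; exact coeff_halfPoly G (by omega)
  rw [hc0, hc1, hc2] at h
  have hk1 : ((-1 : ℝ) ^ k) ^ 2 = 1 := by rw [← pow_mul, pow_mul', neg_one_sq, one_pow]
  have e1 : (-1 : ℝ) ^ (k + 2) * (matchingNumber G (k + 2) : ℝ) * ((-1) ^ k * (matchingNumber G k : ℝ)) =
      (matchingNumber G k : ℝ) * matchingNumber G (k + 2) := by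
    rw [pow_add, neg_one_sq, mul_one]
    linear_combination ((matchingNumber G k : ℝ) * matchingNumber G (k + 2)) * hk1
  have e2 : ((-1 : ℝ) ^ (k + 1) * (matchingNumber G (k + 1) : ℝ)) ^ 2 =
      (matchingNumber G (k + 1) : ℝ) ^ 2 := by
    have hk2 : ((-1 : ℝ) ^ (k + 1)) ^ 2 = 1 := by rw [← pow_mul, pow_mul', neg_one_sq, one_pow]
    rw [mul_pow, hk2, one_mul]
  rw [e1, e2] at h
  rw [hi, show k + 1 - 1 = k by omega, show i + k + 2 - (k + 1) = i + 1 by omega]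
  have h' : ((k + 1 + 1) * (i + 1 + 1) : ℝ) * ((matchingNumber G k : ℝ) * matchingNumber G (k + 1 + 1)) ≤
      ((k + 1) * (i + 1) : ℝ) * (matchingNumber G (k + 1) : ℝ) ^ 2 := by
    have := h; ring_nf; ring_nf at this; linarith
  exact_mod_cast h'

/-- **The matching numbers are log-concave**: `p(G, d−1) p(G, d+1) ≤ p(G, d)²` for every `d ≥ 1`
(Theorem 7.1 with the factor `(1 + 1/d)(1 + 1/(M−d)) ≥ 1` dropped; for `d ≥ M`, `p(G, d+1) = 0`).
[cite: HeilmannLieb1972, §VII Theorem 7.1 with Remark 7.1, held p0027] -/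
theorem matchingNumber_logConcave {d : ℕ} (hd : 0 < d) :
    matchingNumber G (d - 1) * matchingNumber G (d + 1) ≤ matchingNumber G d ^ 2 := by
  rcases Nat.lt_or_ge d (Fintype.card V / 2) with hdM | hdM
  · have h := matchingNumber_newton G hd hdM
    have hle : d * (Fintype.card V / 2 - d) ≤ (d + 1) * (Fintype.card V / 2 - d + 1) :=
      Nat.mul_le_mul (Nat.le_succ d) (Nat.le_succ _)
    have h2 := h.trans (Nat.mul_le_mul_right _ hle)
    exact Nat.le_of_mul_le_mul_left h2 (by positivity)
  · rw [matchingNumber_eq_zero_of_lt (r := d + 1) (by omega), mul_zero]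
    exact Nat.zero_le _

end Literature.Combinatorics.SimpleGraph.MatchingNumbersLogConcave
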